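import Summits.NavierStokesRegularity.NavierStokesRegularity.Theses.LevelSetModeration
import Summits.NavierStokesRegularity.NavierStokesRegularity.Theorems.LevelSetModerationHighSpeedPressureWorkIsoSpeedStubs
import Summits.NavierStokesRegularity.NavierStokesRegularity.Theorems.LevelSetModerationHighSpeedPressureWorkDyadicExtinction
import Summits.NavierStokesRegularity.NavierStokesRegularity.Theorems.LevelSetModerationHighSpeedPressureWorkLateBookkeeping
import HarnessLib

/-!
# Line `line-iso-speed-area-closure` — skeleton of the crux `HighSpeedPressureWork`
# (route LevelSetModeration, item stmt-NavierStokesRegularity-18149; lead a1, rebuilt from the four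
# registered signatures — the planner's file sits in the unmounted evidence store)

The crux: for every `ν, T > 0` there are `m < 10/3` and a modulus `F` such that every classical
Leray–Hopf solution on `ℝ³ × [0,T)` from a rapidly decaying datum with `∫|u₀|² ≤ E₀`, `|u₀| ≤ B₀`
satisfies, for `M ≥ 2B₀`, `c ∈ [M/2, M]`, `t < T`,
`PW_c(t) := −∫₀ᵗ∫ (1−c/|u|)₊ ∇p̃·u ≤ √(F(E₀,B₀) M^m V_c(T)) · √(D_c(T))`,
`V_c(T) = ∫₀ᵀ |{|u|>c}|` (occupation), `D_c(T) = ∫₀ᵀ∫ 1_{|u|>c} |∇|u||²`,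
`𝒟¹_c(T) = ∫₀ᵀ∫ 1_{|u|>c} |∇|u||` (coarea: total AREA of the iso-speed surfaces above `c`).

LINE (idea `iso-speed-area-closure`, triage r2 pass 2/2). Spine: AREA LAW ⇒ bounded ⇒ bookkeeping.
* `stub_isoSpeedAreaLaw` (OPEN — the load): `ν 𝒟¹_c(T) ≤ Λ₁(E₀,B₀) M^{m₁} V_c(T)`, `m₁ < 5/3`, on
  all windows `M ≥ 2B₀`. A consequence of the crux (landed crux ⇒ L1, then Cauchy–Schwarz
  `𝒟¹ ≤ √(V D)`, `m₁ = m/2`); regularity-complete (STRATEGY-CENSUS (E)).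
* `stub_linearLevelRecursion` (LANDED: p158331 + packaging p159709): `V_{2c} ≤ C E₀^{1/3} c^{-5/3} 𝒟¹_c`
  (slice Gagliardo–Nirenberg `W^{1,1} → L^{3/2}` on `(|u|−c)₊` + energy Chebyshev).
* `stub_occupationQuantum` (LANDED: p159045 + packaging p159709): a member of the
  class bounded by `G ≥ A₀B₀` on `[0,T']` that exceeds `3G/4` somewhere occupies at least one viscous
  cell above `G/2`: `V_{G/2}(T) ≥ κ ν⁴/G⁵`.
* `stub_areaLawClosure` (LANDED p161363, `…DyadicExtinction.lean` — dyadic extinction): the three displays above force a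
  class-uniform speed bound: with `θ(c) = C E₀^{1/3} Λ₁⁺ 2^{m₁} ν⁻¹ c^{m₁−5/3} ≤ ½` from `c₁` on,
  `V_{2^k c₁} ≤ (T E₀/c₁²) 2^{−γk(k−1)/2}` (`γ = 5/3 − m₁ > 0`) is super-geometric while the quantum at
  the running maximum `S ∈ [2^{k+1}c₁, 2^{k+2}c₁)` demands `V_{S/2} ≥ κν⁴ 2^{−5k−10} c₁^{−5}`; so
  `k` is bounded and `S ≤ G(ν,T,m₁,Λ₁,E₀,B₀,C,κ,A₀)`.
* `stub_boundedPairingBookkeeping` (= L3 of line `linear_closure`, shared; bounded-strength): under a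
  class-uniform speed bound the pairing obeys the product bound with exponent `0`.
* `HighSpeedPressureWork_of`: the crux BY NAME (real proof): `(m₁, Λ₁)` from the area law, `(C)` and
  `(κ, A₀)` from the two packaging stubs, `G(E₀,B₀)` from the closure, `F` from the bookkeeping;
  exponent `0 < 10/3`, `M^0 = 1`.
-/

set_option linter.dupNamespace false

noncomputable section

open MeasureTheory Set Filter Topology
open scoped ENNReal

namespace Summit.NavierStokesRegularity.NavierStokesRegularity.Cruxes.HighSpeedPressureWork.IsoSpeedAreaClosure

open Literature.Analysis.FluidPDE
open Summit.NavierStokesRegularity.NavierStokesRegularity.Theses.LevelSetModeration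

/-- **STUB (OPEN — the load; iso-speed AREA law).** For every `ν, T > 0` there are `m₁ < 5/3` and a
modulus `Λ₁` such that every classical Leray–Hopf solution from a rapidly decaying datum with
`∫|u₀|² ≤ E₀`, `|u₀| ≤ B₀` satisfies, on all windows `M ≥ 2B₀`, `c ∈ [M/2,M]`, `c > 0`:
`ν · 𝒟¹_c(T) ≤ Λ₁(E₀,B₀) · M^{m₁} · V_c(T)` — viscosity times the total area of the iso-speed
surfaces above `c` is controlled linearly by `M^{m₁} ×` the occupation above `c`. Implied by the crux
(`m₁ = m/2`, `Λ₁ = √F⁺`); regularity-complete; `EnergySupercriticality` conceded exactly here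
(`ν𝒟¹/V ∼ M²` is the scaling value, `m₁ < 5/3` asks a gain `A^{−1/3}` in the amplification). -/
theorem stub_isoSpeedAreaLaw :
    ∀ (ν T : ℝ), 0 < ν → 0 < T → ∃ m₁ : ℝ, m₁ < 5 / 3 ∧ ∃ Λ₁ : ℝ → ℝ → ℝ, ∀ (u : ℝ → EuclideanSpace ℝ (Fin 3) → EuclideanSpace ℝ (Fin 3)) (p : ℝ → EuclideanSpace ℝ (Fin 3) → ℝ), Literature.Analysis.FluidPDE.IsClassicalNSSolutionOn (Set.Ico 0 T) ν 0 u p → Literature.Analysis.FluidPDE.IsLerayHopfOn T ν 0 (u 0) u → Literature.Analysis.FluidPDE.HasRapidSpatialDecay (u 0) → ∀ (E₀ B₀ : ℝ), (∫ x, ‖u 0 x‖ ^ 2) ≤ E₀ → (∀ x, ‖u 0 x‖ ≤ B₀) → ∀ (M c : ℝ), 2 * B₀ ≤ M → M / 2 ≤ c → c ≤ M → 0 < c → ν * (∫⁻ τ in Set.Ioo 0 T, ∫⁻ x, Set.indicator {x | c < ‖u τ x‖} (fun x => ENNReal.ofReal ‖fderiv ℝ (fun y => ‖u τ y‖) x‖)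 x).toReal ≤ Λ₁ E₀ B₀ * M ^ m₁ * (∫⁻ τ in Set.Ioo 0 T, volume {x | c < ‖u τ x‖}).toReal := by
  sorry

/-- **STUB (packaging of the landed linear dyadic level recursion, p158331).** One absolute `C > 0`:
for every member of the data class and every level `c > 0`, the iso-speed area functional above `c`
is finite and `V_{2c}(T) ≤ C E₀^{1/3} c^{−5/3} 𝒟¹_c(T)` (real form). -/
theorem stub_linearLevelRecursion :
    ∃ C : ℝ, 0 < C ∧ ∀ (ν T : ℝ) (u : ℝ → EuclideanSpace ℝ (Fin 3) → EuclideanSpace ℝ (Fin 3)) (p : ℝ → EuclideanSpace ℝ (Fin 3) → ℝ), 0 < ν → 0 < T → Literature.Analysis.FluidPDE.IsClassicalNSSolutionOn (Set.Ico 0 T) ν 0 u p → Literature.Analysis.FluidPDE.IsLerayHopfOn T ν 0 (u 0) u → Literature.Analysis.FluidPDE.HasRapidSpatialDecay (u 0) → ∀ (E₀ c : ℝ), (∫ x, ‖u 0 x‖ ^ 2) ≤ E₀ → 0 < c → (∫⁻ τ in Set.Ioo 0 T, ∫⁻ x, Set.indicator {x | c < ‖u τ x‖} (fun x => ENNReal.ofReal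 ‖fderiv ℝ (fun y => ‖u τ y‖) x‖) x) ≠ ⊤ ∧ (∫⁻ τ in Set.Ioo 0 T, volume {x | 2 * c < ‖u τ x‖}).toReal ≤ C * E₀ ^ (1 / 3 : ℝ) * c ^ (-(5 / 3 : ℝ)) * (∫⁻ τ in Set.Ioo 0 T, ∫⁻ x, Set.indicator {x | c < ‖u τ x‖} (fun x => ENNReal.ofReal ‖fderiv ℝ (fun y => ‖u τ y‖) x‖) x).toReal :=
  Summit.NavierStokesRegularity.NavierStokesRegularity.Theorems.stub_linearLevelRecursion

/-- **STUB (packaging of the landed occupation quantum p159045 with the early window p157609).**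
Absolute `κ, A₀ > 0`: a member of the class with `|u₀| ≤ B₀` (`B₀ > 0`), bounded by `G ≥ A₀B₀` on
`[0,T'] × ℝ³` (`T' < T`) and exceeding `3G/4` at some point of `[0,T'] × ℝ³`, occupies at least one
viscous cell above `G/2`: `κ ν⁴/G⁵ ≤ V_{G/2}(T)` (the early window forces that point beyond
`c₀ν/B₀² ≥ 3ν/G²`; continuity in time moves it off `T'`). -/
theorem stub_occupationQuantum :
    ∃ κ A₀ : ℝ, 0 < κ ∧ 0 < A₀ ∧ ∀ (ν T : ℝ) (u : ℝ → EuclideanSpace ℝ (Fin 3) → EuclideanSpace ℝ (Fin 3)) (p : ℝ → EuclideanSpace ℝ (Fin 3) → ℝ), 0 < ν → 0 < T → Literature.Analysis.FluidPDE.IsClassicalNSSolutionOn (Set.Ico 0 T) ν 0 u p → Literature.Analysis.FluidPDE.IsLerayHopfOn T ν 0 (u 0) u → Literature.Analysis.FluidPDE.HasRapidSpatialDecay (u 0) → ∀ (B₀ : ℝ), 0 < B₀ → (∀ x, ‖u 0 x‖ ≤ B₀) → ∀ (T' G : ℝ), T' < T → A₀ * B₀ ≤ G → (∀ t ∈ Set.Icc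 0 T', ∀ x, ‖u t x‖ ≤ G) → (∃ t ∈ Set.Icc 0 T', ∃ x, 3 / 4 * G < ‖u t x‖) → κ * ν ^ 4 / G ^ 5 ≤ (∫⁻ τ in Set.Ioo 0 T, volume {x | G / 2 < ‖u τ x‖}).toReal :=
  Summit.NavierStokesRegularity.NavierStokesRegularity.Theorems.stub_occupationQuantum

/-- **STUB (NEW, provable now — the closure by dyadic extinction).** For `ν, T > 0`, `m₁ < 5/3`, a
real `Λ₁`, data bounds `(E₀, B₀)` and absolute constants `C, κ, A₀ > 0` there is `G` such that every
member of the class with `∫|u₀|² ≤ E₀`, `|u₀| ≤ B₀` which obeys (i) the linear level recursion with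
constant `C` at every level, (ii) the occupation quantum with `(κ, A₀)` at every datum bound, and
(iii) the area law with `(Λ₁, m₁)` on all windows `M ≥ 2B₀`, is bounded by `G` on `[0,T) × ℝ³`.
Mechanism: `V_{2c} ≤ θ(c) V_c`, `θ(c) = C E₀^{1/3} Λ₁⁺ 2^{m₁} ν⁻¹ c^{−γ}`, `γ = 5/3 − m₁ > 0`, so from
the level `c₁ = max(B₀, 1, (2K)^{1/γ})` on the occupation decays super-geometrically,
`V_{2^k c₁} ≤ (T E₀/c₁²) 2^{−γ k(k−1)/2}`, while at the running maximum `S` of `|u|` over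
`[0,t] × ℝ³` (finite: Tao-class slab bound) the quantum gives `V_{S/2} ≥ κν⁴/S⁵`; with
`2^{k+1}c₁ ≤ S < 2^{k+2}c₁` this bounds `k`, hence `S`, class-uniformly. -/
theorem stub_areaLawClosure :
    ∀ (ν T m₁ Λ₁ E₀ B₀ C κ A₀ : ℝ), 0 < ν → 0 < T → m₁ < 5 / 3 → 0 < C → 0 < κ → 0 < A₀ → ∃ G : ℝ,
      ∀ (u : ℝ → EuclideanSpace ℝ (Fin 3) → EuclideanSpace ℝ (Fin 3))
        (p : ℝ → EuclideanSpace ℝ (Fin 3) → ℝ),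
        Literature.Analysis.FluidPDE.IsClassicalNSSolutionOn (Set.Ico 0 T) ν 0 u p →
        Literature.Analysis.FluidPDE.IsLerayHopfOn T ν 0 (u 0) u →
        Literature.Analysis.FluidPDE.HasRapidSpatialDecay (u 0) →
        (∫ x, ‖u 0 x‖ ^ 2) ≤ E₀ → (∀ x, ‖u 0 x‖ ≤ B₀) →
        (∀ c : ℝ, 0 < c →
          (∫⁻ τ in Set.Ioo 0 T, ∫⁻ x, Set.indicator {x | c < ‖u τ x‖}
              (fun x => ENNReal.ofReal ‖fderiv ℝ (fun y => ‖u τ y‖) x‖) x) ≠ ⊤ ∧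
            (∫⁻ τ in Set.Ioo 0 T, volume {x | 2 * c < ‖u τ x‖}).toReal ≤
              C * E₀ ^ (1 / 3 : ℝ) * c ^ (-(5 / 3 : ℝ)) *
                (∫⁻ τ in Set.Ioo 0 T, ∫⁻ x, Set.indicator {x | c < ‖u τ x‖}
                  (fun x => ENNReal.ofReal ‖fderiv ℝ (fun y => ‖u τ y‖) x‖) x).toReal) →
        (∀ B₁ : ℝ, 0 < B₁ → (∀ x, ‖u 0 x‖ ≤ B₁) → ∀ (T' G' : ℝ), T' < T → A₀ * B₁ ≤ G' →
          (∀ t ∈ Set.Icc 0 T', ∀ x, ‖u t x‖ ≤ G') → (∃ t ∈ Set.Icc 0 T', ∃ x, 3 / 4 * G' < ‖u t x‖) →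
          κ * ν ^ 4 / G' ^ 5 ≤ (∫⁻ τ in Set.Ioo 0 T, volume {x | G' / 2 < ‖u τ x‖}).toReal) →
        (∀ (M c : ℝ), 2 * B₀ ≤ M → M / 2 ≤ c → c ≤ M → 0 < c →
          ν * (∫⁻ τ in Set.Ioo 0 T, ∫⁻ x, Set.indicator {x | c < ‖u τ x‖}
              (fun x => ENNReal.ofReal ‖fderiv ℝ (fun y => ‖u τ y‖) x‖) x).toReal ≤
            Λ₁ * M ^ m₁ * (∫⁻ τ in Set.Ioo 0 T, volume {x | c < ‖u τ x‖}).toReal) →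
        ∀ t ∈ Set.Ico 0 T, ∀ x, ‖u t x‖ ≤ G :=
  Summit.NavierStokesRegularity.NavierStokesRegularity.Theorems.stub_areaLawClosure

/-- **STUB L3-E (EARLY bookkeeping; unconditional, bounded-amplification ≤ 2).** One absolute
dimensionless `cₑ > 0` such that on every fibre `(ν, T)` some modulus `F(E₀,B₀)` bounds the pairing on
the EARLY window `t ≤ cₑ ν/B₀²` (where the speed is `≤ 2B₀` class-uniformly, landed
`levelSetModeration_earlyWindow`, but no gradient / time-derivative bound is class-uniform):
`-(∫ τ in Set.Ioo 0 t, ∫ x, max (1 - c / ‖u τ x‖) 0 * (fderiv ℝ (Literature.Analysis.FluidPDE.normalisedPressure (u τ)) x (u τ x)))_c(t) ≤ √(F V_c(T)) √(D_c(T))` for admissible `(M, c)`. A consequence of the crux (levels with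
occupation have `M < 4B₀`, so `M^m` is absorbed); the one piece of the line whose truth at bounded
amplification rests on heuristics (crux strategist N5/D2: flat cores, no fat brief flash before the
smoothing time) — the disprover's natural target. -/
theorem stub_earlyBookkeeping :
    ∃ cₑ : ℝ, 0 < cₑ ∧ ∀ (ν T : ℝ), 0 < ν → 0 < T → ∃ F : ℝ → ℝ → ℝ, ∀ (u : ℝ → EuclideanSpace ℝ (Fin 3) → EuclideanSpace ℝ (Fin 3)) (p : ℝ → EuclideanSpace ℝ (Fin 3) → ℝ), Literature.Analysis.FluidPDE.IsClassicalNSSolutionOn (Set.Ico 0 T) ν 0 u p → Literature.Analysis.FluidPDE.IsLerayHopfOn T ν 0 (u 0) u → Literature.Analysis.FluidPDE.HasRapidSpatialDecay (u 0) → ∀ (E₀ B₀ : ℝ), (∫ x, ‖u 0 x‖ ^ 2) ≤ E₀ → (∀ x, ‖u 0 x‖ ≤ B₀) → ∀ (M c t : ℝ), 2 * B₀ ≤ M → M / 2 ≤ c → c ≤ M → 0 < c → t ∈ Set.Ico 0 T → t ≤ cₑ * ν / B₀ ^ 2 → -(∫ τ in Set.Ioo 0 t, ∫ x, max (1 - c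 / ‖u τ x‖) 0 * (fderiv ℝ (Literature.Analysis.FluidPDE.normalisedPressure (u τ)) x (u τ x))) ≤ Real.sqrt (F E₀ B₀ * (∫⁻ τ in Set.Ioo 0 T, volume {x | c < ‖u τ x‖}).toReal) * Real.sqrt ((∫⁻ τ in Set.Ioo 0 T, ∫⁻ x, Set.indicator {x | c < ‖u τ x‖} (fun x => ENNReal.ofReal (‖fderiv ℝ (fun y => ‖u τ y‖) x‖ ^ 2)) x).toReal) := by
  sorry

/-- Monotonicity of the right-hand side in the modulus: `√(F₁ V) √D ≤ √(F V) √D` when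
`max F₁ 0 ≤ F` and `V ≥ 0`. -/
theorem rhs_mono {F₁ F V D : ℝ} (hF : max F₁ 0 ≤ F) (hV : 0 ≤ V) :
    Real.sqrt (F₁ * V) * Real.sqrt D ≤ Real.sqrt (F * V) * Real.sqrt D := by
  refine mul_le_mul_of_nonneg_right (Real.sqrt_le_sqrt ?_) (Real.sqrt_nonneg _)
  exact (mul_le_mul_of_nonneg_right (le_max_left _ _) hV).trans (mul_le_mul_of_nonneg_right hF hV)

/-- **L3 (= `stub_boundedPairingBookkeeping`) from the EARLY stub and the LANDED late bookkeeping**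
(`levelSetModeration_latePairingBookkeeping`, seat 0, p16xxxx: after the delay `cₑν/B₀²` the
solution is Lipschitz in space, the normalised pressure is bounded pointwise by Stein's estimate,
and slice integration by parts gives the pairing bound over every late time window). Split the
time integral of the pairing at `t₁ = cₑν/B₀²`: `PW_c(t) = PW_c(t₁) + late ≤ √(F_E V)√D + √(F_L V)√D`
when the pairing slice is integrable on `(0,t)`; otherwise the Bochner integral `PW_c(t)` is `0`.
Modulus `F = (√F_E⁺ + √F_L⁺)²`. (The registered late pieces `stub_lateViscousBookkeeping` — LANDED
p163584 — and `stub_lateKineticBookkeeping` of skeleton v3 are no longer on the critical path.) -/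
theorem stub_boundedPairingBookkeeping :
    ∀ (ν T : ℝ), 0 < ν → 0 < T → ∀ G : ℝ → ℝ → ℝ, (∀ (u : ℝ → EuclideanSpace ℝ (Fin 3) → EuclideanSpace ℝ (Fin 3)) (p : ℝ → EuclideanSpace ℝ (Fin 3) → ℝ), Literature.Analysis.FluidPDE.IsClassicalNSSolutionOn (Set.Ico 0 T) ν 0 u p → Literature.Analysis.FluidPDE.IsLerayHopfOn T ν 0 (u 0) u → Literature.Analysis.FluidPDE.HasRapidSpatialDecay (u 0) → ∀ (E₀ B₀ : ℝ), (∫ x, ‖u 0 x‖ ^ 2) ≤ E₀ → (∀ x, ‖u 0 x‖ ≤ B₀) → ∀ t ∈ Set.Ico 0 T, ∀ x, ‖u t x‖ ≤ G E₀ B₀) → ∃ F : ℝ → ℝ → ℝ, ∀ (u : ℝ → EuclideanSpace ℝ (Fin 3) → EuclideanSpace ℝ (Fin 3)) (p : ℝ → EuclideanSpace ℝ (Fin 3) → ℝ), Literature.Analysis.FluidPDE.IsClassicalNSSolutionOn (Set.Ico 0 T) ν 0 u p → Literature.Analysis.FluidPDE.IsLerayHopfOn T ν 0 (u 0) u → Literature.Analysis.FluidPDE.HasRapidSpatialDecay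 (u 0) → ∀ (E₀ B₀ : ℝ), (∫ x, ‖u 0 x‖ ^ 2) ≤ E₀ → (∀ x, ‖u 0 x‖ ≤ B₀) → ∀ (M c t : ℝ), 2 * B₀ ≤ M → M / 2 ≤ c → c ≤ M → 0 < c → t ∈ Set.Ico 0 T → -(∫ τ in Set.Ioo 0 t, ∫ x, max (1 - c / ‖u τ x‖) 0 * (fderiv ℝ (Literature.Analysis.FluidPDE.normalisedPressure (u τ)) x (u τ x))) ≤ Real.sqrt (F E₀ B₀ * (∫⁻ τ in Set.Ioo 0 T, volume {x | c < ‖u τ x‖}).toReal) * Real.sqrt ((∫⁻ τ in Set.Ioo 0 T, ∫⁻ x, Set.indicator {x | c < ‖u τ x‖} (fun x => ENNReal.ofReal (‖fderiv ℝ (fun y => ‖u τ y‖) x‖ ^ 2)) x).toReal) := by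
  intro ν T hν hT G hG
  obtain ⟨cₑ, hcₑ, hEarly⟩ := stub_earlyBookkeeping
  obtain ⟨F₁, hF₁⟩ := hEarly ν T hν hT
  obtain ⟨F₂, hF₂⟩ :=
    Summit.NavierStokesRegularity.NavierStokesRegularity.Theorems.levelSetModeration_latePairingBookkeeping
      ν T hν hT G hG cₑ hcₑ
  refine ⟨fun E₀ B₀ => (Real.sqrt (max (F₁ E₀ B₀) 0) + Real.sqrt (max (F₂ E₀ B₀) 0)) ^ 2, ?_⟩
  intro u p hcl hLH hdec E₀ B₀ hE hB M c t hM hMc hcM hc ht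
  set V : ℝ := (∫⁻ τ in Set.Ioo 0 T, volume {x | c < ‖u τ x‖}).toReal with hVdef
  set D : ℝ := (∫⁻ τ in Set.Ioo 0 T, ∫⁻ x, Set.indicator {x | c < ‖u τ x‖} (fun x => ENNReal.ofReal (‖fderiv ℝ (fun y => ‖u τ y‖) x‖ ^ 2)) x).toReal with hDdef
  set a₁ : ℝ := Real.sqrt (max (F₁ E₀ B₀) 0) with ha₁
  set a₂ : ℝ := Real.sqrt (max (F₂ E₀ B₀) 0) with ha₂
  have hV0 : 0 ≤ V := ENNReal.toReal_nonneg
  have ha₁0 : 0 ≤ a₁ := Real.sqrt_nonneg _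
  have ha₂0 : 0 ≤ a₂ := Real.sqrt_nonneg _
  have hS0 : 0 ≤ Real.sqrt V * Real.sqrt D := by positivity
  have htarget : Real.sqrt ((a₁ + a₂) ^ 2 * V) * Real.sqrt D =
      a₁ * (Real.sqrt V * Real.sqrt D) + a₂ * (Real.sqrt V * Real.sqrt D) := by
    rw [Real.sqrt_mul (sq_nonneg _), Real.sqrt_sq (by positivity)]; ring
  have hpiece : ∀ Fi : ℝ, Real.sqrt (Fi * V) * Real.sqrt D ≤
      Real.sqrt (max Fi 0) * (Real.sqrt V * Real.sqrt D) := by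
    intro Fi
    rw [← mul_assoc, ← Real.sqrt_mul (le_max_right _ _)]
    exact rhs_mono le_rfl hV0
  rw [htarget]
  by_cases hearly : t ≤ cₑ * ν / B₀ ^ 2
  · have h1 := hF₁ u p hcl hLH hdec E₀ B₀ hE hB M c t hM hMc hcM hc ht hearly
    have h2 := hpiece (F₁ E₀ B₀)
    nlinarith [h1, h2, mul_nonneg ha₂0 hS0]
  · push Not at hearly
    set t₁ : ℝ := cₑ * ν / B₀ ^ 2 with ht₁
    have ht₁0 : 0 ≤ t₁ := by rw [ht₁]; positivity
    have ht₁T : t₁ ∈ Set.Ico 0 T := ⟨ht₁0, hearly.trans ht.2⟩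
    have hE₁ := hF₁ u p hcl hLH hdec E₀ B₀ hE hB M c t₁ hM hMc hcM hc ht₁T le_rfl
    have hL := hF₂ u p hcl hLH hdec E₀ B₀ hE hB M c t hM hMc hcM hc ht hearly.le
    have h2E := hpiece (F₁ E₀ B₀)
    have h2L := hpiece (F₂ E₀ B₀)
    set g : ℝ → ℝ := fun τ => ∫ x, max (1 - c / ‖u τ x‖) 0 *
      (fderiv ℝ (Literature.Analysis.FluidPDE.normalisedPressure (u τ)) x (u τ x)) with hg
    by_cases hint : IntegrableOn g (Set.Ioo 0 t) volume
    · -- split the time integral at `t₁`: `Ioo 0 t = Ioc 0 t₁ ∪ Ioo t₁ t`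
      have hunion : Set.Ioo 0 t = Set.Ioc 0 t₁ ∪ Set.Ioo t₁ t := by
        ext τ
        simp only [Set.mem_Ioo, Set.mem_union, Set.mem_Ioc]
        constructor
        · rintro ⟨h0, h1⟩
          rcases le_or_gt τ t₁ with h | h
          · exact Or.inl ⟨h0, h⟩
          · exact Or.inr ⟨h, h1⟩
        · rintro (⟨h0, h1⟩ | ⟨h0, h1⟩)
          · exact ⟨h0, h1.trans_lt hearly⟩
          · exact ⟨ht₁0.trans_lt h0, h1⟩
      have hdisj : Disjoint (Set.Ioc 0 t₁) (Set.Ioo t₁ t) := by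
        rw [Set.disjoint_left]
        rintro τ ⟨-, h1⟩ ⟨h2, -⟩
        exact absurd (h1.trans_lt h2) (lt_irrefl _)
      have hsplit : (∫ τ in Set.Ioo 0 t, g τ) = (∫ τ in Set.Ioo 0 t₁, g τ) + ∫ τ in Set.Ioo t₁ t, g τ := by
        rw [hunion, MeasureTheory.setIntegral_union hdisj measurableSet_Ioo
          (hint.mono_set (by rw [hunion]; exact Set.subset_union_left))
          (hint.mono_set (by rw [hunion]; exact Set.subset_union_right)),
          MeasureTheory.setIntegral_congr_set (Ioo_ae_eq_Ioc (μ := volume) (a := 0) (b := t₁))]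
      have hsplit' : -(∫ τ in Set.Ioo 0 t, g τ) =
          -(∫ τ in Set.Ioo 0 t₁, g τ) + -(∫ τ in Set.Ioo t₁ t, g τ) := by rw [hsplit]; ring
      simp only [hg] at hsplit'
      rw [hsplit']
      nlinarith [hE₁, hL, h2E, h2L]
    · -- non-integrable pairing slice: the Bochner integral vanishes
      have h0 : (∫ τ in Set.Ioo 0 t, g τ) = 0 := MeasureTheory.integral_undef hint
      simp only [hg] at h0
      rw [h0, neg_zero]
      positivity

/-- **The crux BY NAME from the five stubs** (sorries live only in `stub_*`): `(m₁, Λ₁)` from the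
area law, the absolute constants of the recursion and of the quantum, the class-uniform bound
`G(E₀,B₀)` from the closure, the modulus `F` from the bookkeeping; exponent `0 < 10/3` (`M^0 = 1`). -/
theorem HighSpeedPressureWork_of :
    Summit.NavierStokesRegularity.NavierStokesRegularity.Theses.LevelSetModeration.HighSpeedPressureWork := by
  intro ν T hν hT
  obtain ⟨m₁, hm₁, Λ₁, hlaw⟩ := stub_isoSpeedAreaLaw ν T hν hT
  obtain ⟨C, hC, hrec⟩ := stub_linearLevelRecursion
  obtain ⟨κ, A₀, hκ, hA₀, hq⟩ := stub_occupationQuantum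
  -- class-uniform speed bound on every data fibre `(E₀, B₀)`
  have hGex : ∀ E₀ B₀ : ℝ, ∃ G : ℝ,
      ∀ (u : ℝ → EuclideanSpace ℝ (Fin 3) → EuclideanSpace ℝ (Fin 3))
        (p : ℝ → EuclideanSpace ℝ (Fin 3) → ℝ),
        Literature.Analysis.FluidPDE.IsClassicalNSSolutionOn (Set.Ico 0 T) ν 0 u p →
        Literature.Analysis.FluidPDE.IsLerayHopfOn T ν 0 (u 0) u →
        Literature.Analysis.FluidPDE.HasRapidSpatialDecay (u 0) →
        (∫ x, ‖u 0 x‖ ^ 2) ≤ E₀ → (∀ x, ‖u 0 x‖ ≤ B₀) →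
        ∀ t ∈ Set.Ico 0 T, ∀ x, ‖u t x‖ ≤ G := by
    intro E₀ B₀
    obtain ⟨G, hG⟩ := stub_areaLawClosure ν T m₁ (Λ₁ E₀ B₀) E₀ B₀ C κ A₀ hν hT hm₁ hC hκ hA₀
    refine ⟨G, fun u p hcl hLH hdec hE hB₀ => hG u p hcl hLH hdec hE hB₀ ?_ ?_ ?_⟩
    · intro c hc
      exact hrec ν T u p hν hT hcl hLH hdec E₀ c hE hc
    · intro B₁ hB₁ hB₁' T' G' hT' hG' hbd hpt
      exact hq ν T u p hν hT hcl hLH hdec B₁ hB₁ hB₁' T' G' hT' hG' hbd hpt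
    · intro M c hM hMc hcM hc
      exact hlaw u p hcl hLH hdec E₀ B₀ hE hB₀ M c hM hMc hcM hc
  choose G hG using hGex
  obtain ⟨F, hF⟩ := stub_boundedPairingBookkeeping ν T hν hT G
    (fun u p hcl hLH hdec E₀ B₀ hE hB₀ => hG E₀ B₀ u p hcl hLH hdec hE hB₀)
  refine ⟨0, by norm_num, F, ?_⟩
  intro u p hcl hLH hdec E₀ B₀ hE hB₀ M c t hM hMc hcM hc ht
  rw [Real.rpow_zero, mul_one]
  exact hF u p hcl hLH hdec E₀ B₀ hE hB₀ M c t hM hMc hcM hc ht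

end Summit.NavierStokesRegularity.NavierStokesRegularity.Cruxes.HighSpeedPressureWork.IsoSpeedAreaClosure

end
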